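import Literature.Probability.LatticeModels.GibbsSpecificationSummable
import Mathlib.Topology.ContinuousMap.Bounded.Basic
import HarnessLib

/-!
# Generalized Gibbs measures: weakly Gibbsian and almost Gibbsian (almost quasilocal) measures

The two «restoration» notions of Dobrushin's programme for non-Gibbsian (e.g. renormalized
low-temperature) measures, AS PRINTED, on top of the tree's DLR vocabulary
(`Specification`, `IsSpecification`, `IsGibbsMeasure`, `Potential`, `hamiltonianTsum`,
`gibbsSpecOfSummablePotential`):

* **weakly Gibbsian** — DLR with respect to a potential that is absolutely summable only on a
  tail-measurable set of full measure (Bricmont–Kupiainen–Lefevere 1998, «Gibbs measure for the pair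
  `(Φ, Ω̄)`»; Maes–Redig–Van Moffaert 1999, Def. 4.3; Dobrushin–Shlosman 1999, «partly defined Gibbs
  specification», (1.12); Le Ny 2008, Def. 32);
* **almost Gibbsian = almost quasilocal** — consistency with a specification whose kernels are
  continuous in the boundary condition except on a set of measure zero (Maes–Redig–Van Moffaert
  1999, Def. 4.2; Fernández–Le Ny–Redig 2003; Le Ny 2008, Def. 33).

Printed statements (verbatim; first-hand records with page/line in the cell file
`run/shared/lean/pub/pub-ymgap/ym3ir/AS-PRINTED.md` §12):

* Bricmont–Kupiainen–Lefevere, CMP 194 (1998) 359–388 (authors' preprint mp_arc 97-244, L426–475):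
  «in order to define `H(s_V | s̄_{V^c})` and `π^Φ_V(s_V | s̄_{V^c})`, it is not necessary to assume
  (2.6) [uniform absolute summability `∑_{X∋0} ‖Φ_X‖_∞ < ∞`]; it is enough to assume the existence of a
  tail set `Ω̄ ⊂ Ω` on which the following pointwise bounds hold: b′) `Ω̄`-pointwise absolutely
  summable: `∑_{X∋x} |Φ_X(s_X)| < ∞ ∀x ∈ ℒ, ∀s ∈ Ω̄`. (2.9) … we can define the specification
  `π^{Φ,Ω̄}` by `π^{Φ,Ω̄}_V(s_V | s̄_{V^c}) = Z⁻¹(s̄_{V^c}) exp(−H(s_V | s̄_{V^c}))` for `s̄_{V^c} ∈ Ω̄`, `0`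
  for `s̄_{V^c} ∉ Ω̄` … Definition. Given a tail set `Ω̄ ⊂ Ω`, `μ` is a Gibbs measure for the pair
  `(Φ, Ω̄)` if `μ(Ω̄) = 1`, and there exists a version of the conditional probabilities that satisfy,
  `∀V ⊂ ℒ`, `|V|` finite, `∀s_V ∈ Ω_V`, `μ(s_V | s̄_{V^c}) = π^{Φ,Ω̄}_V(s_V | s̄_{V^c})` `∀s̄ ∈ Ω̄`.»
* Maes–Redig–Van Moffaert, Stoch. Proc. Appl. 79 (1999) 1–15 (K.U. Leuven preprint pp.14–15):
  «Definition 4.2 A probability measure `μ` on `(Ω, F)` is 1. almost Gibbsian if there exists a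
  uniformly nonnull specification `Γ` such that `μ ∈ G(Γ)` and `μ(Ω_Γ) = 1. … This is equivalent to
  asking that some version of the conditional probabilities of `μ` is continuous … `μ`-almost
  surely.»  «Definition 4.3 A probability measure `μ` on `(Ω, F)` is weakly Gibbsian if there exists
  a potential `U` and a tail field set `Ω_U` such that 1. `U` is absolutely convergent on `Ω_U` …
  2. `μ(Ω_U) = 1` 3. [the DLR equation with the weights `e^{−H^U_Λ}`].»  Thm. 4.1: almost Gibbsian (in
  a direction) ⟹ weakly Gibbsian; §5.2: the converse fails.
* Le Ny, Ensaios Mat. 15 (2008) = arXiv:0712.1171, Defs. 32/33: «A probability measure `μ ∈ M₁(Ω)`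
  is said to be weakly Gibbs if there exists a potential `Φ` and a tail-measurable set `Ω_Φ` on which
  `Φ` is convergent with `μ(Ω_Φ) = 1` such that `μ ∈ G(γ^Φ)`.»  «A probability measure `μ` is almost
  Gibbs if its finite-volume conditional probabilities are continuous functions of the boundary
  conditions, except on a set of `μ`-measure zero, i.e. if there exists a specification `γ` such that
  `μ ∈ G(γ)` and `μ(Ω_γ) = 1`.»

## What is formalised (namespace `Literature.Probability.LatticeModels`)

* `Potential.AbsSummableAt Φ ω` — BKL's b′) at one configuration; `Potential.HasSummableBound`
  (the tree's UNIFORM absolute summability, BKL (2.6)) implies it everywhere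
  (`Potential.HasSummableBound.absSummableAt`).
* `IsTailMeasurable A` — `A` is measurable for every outside σ-algebra `𝓕_{Λᶜ}`.
* `gibbsSpecOn ν Φ Ω̄ β` — BKL's partly defined specification `π^{Φ,Ω̄}`: the tree's
  `gibbsSpecOfSummablePotential ν Φ β` on `Ω̄`, the ZERO measure off `Ω̄` (verbatim BKL).
* `IsWeaklyGibbsFor ν Φ Ω̄ β μ` / `IsWeaklyGibbs ν μ` — BKL's Definition / MRvM Def. 4.3 / Le Ny
  Def. 32, junk-free DLR form as in `IsGibbsMeasure`.
* `Specification.continuitySet γ` (MRvM's `Ω_Γ`) and `IsAlmostGibbs μ` — Le Ny Def. 33 / MRvM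
  Def. 4.2 WITHOUT MRvM's extra «uniformly nonnull» requirement on `Γ` (Le Ny and
  Fernández–Le Ny–Redig 2003 do not impose it; recorded, not encoded).
* PROVED API: `gibbsSpecOn_of_mem` / `gibbsSpecOn_of_not_mem`; `gibbsSpecOn_univ`;
  `isWeaklyGibbsFor_univ_iff` (on `Ω̄ = univ` the notion IS «absolutely summable everywhere + DLR for
  the Gibbsian specification of `β Φ`»); `IsGibbsMeasure.isWeaklyGibbsFor_univ` (a Gibbs measure of a uniformly absolutely summable
  potential is weakly Gibbsian with `Ω̄ = univ` — the trivial direction of BKL's remark «this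
  definition is very similar to the usual one»); `Specification.continuitySet_eq_univ` and
  `IsGibbsMeasure.isAlmostGibbs_of_continuous` (a Gibbs measure for a specification with
  continuous = Feller kernels is almost Gibbs, MRvM Remark 1 after Def. 4.2: «every Gibbs measure
  is almost Gibbsian»).

No named facts (`def … : Prop` without arguments), no `sorry`; MRvM Thm. 4.1 (almost ⟹ weakly,
via Kozlov–Sullivan potentials) and the counterexample of §5.2 are NOT formalised here.
Use in this project: the typed CURRENCY for the «in mean / almost surely» distinction of
pub-ymgap track Y4 (`Summits/Ventures/YMGap/YM3IR/InMean.lean`) and for evasion (e) of the barrier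
`Literature.Barriers.CriticalPhenomena.PositionSpaceRGNonGibbsian`; every printed instance is a
scalar (Ising / lattice-gas) system — nothing here is about gauge theories.

## References
* [BricmontKupiainenLefevere1998] J. Bricmont, A. Kupiainen, R. Lefevere, CMP 194 (1998) 359–388,
  §2 (2.9), Definition before Theorem 1 (preprint mp_arc 97-244 L426–495).
* [MaesRedigVanmoffaertSPA1999] C. Maes, F. Redig, A. Van Moffaert, Stoch. Proc. Appl. 79 (1999)
  1–15, Defs. 4.1–4.3, Thm. 4.1.
* [DobrushinShlosman1999] R. L. Dobrushin, S. B. Shlosman, CMP 200 (1999) 125–179, p.128 (1.12).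
* [Leny2008] A. Le Ny, Ensaios Mat. 15 (2008), Defs. 32–34.
* [FernandezLenyRedig2003] R. Fernández, A. Le Ny, F. Redig, J. Stat. Phys. 111 (2003) 465–478.
* [Georgii2011] H.-O. Georgii, Gibbs Measures and Phase Transitions, Def. 1.23, Def. 2.9.
-/

noncomputable section

open MeasureTheory Filter Finset Function
open scoped Topology ENNReal BoundedContinuousFunction

namespace Literature.Probability.LatticeModels

variable {V S : Type*} [DecidableEq V] [MeasurableSpace S]

/-! ### Pointwise absolute summability of a potential (BKL (2.9)) -/

/-- **`Ω̄`-pointwise absolute summability at one configuration** (Bricmont–Kupiainen–Lefevere 1998,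
condition b′), eq. (2.9): `∑_{X∋x} |Φ_X(s)| < ∞` for every site `x`, at the configuration `s`;
Maes–Redig–Van Moffaert 1999, Def. 2.6 / Def. 4.3 (1) «`U` is absolutely convergent on `Ω_U`»;
Dobrushin–Shlosman 1999, p.128: the set of boundary conditions for which «the series (1.2) absolutely
converges»). Written, as in `Potential.HasSummableBound`, as summability over all finite sets with
the terms not containing the site set to `0`. [cite: BricmontKupiainenLefevere1998, eq. (2.9)] -/
def Potential.AbsSummableAt (Φ : Potential V S) (ω : V → S) : Prop :=
  ∀ i : V, Summable fun B : Finset V => if i ∈ B then |Φ B ω| else 0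

omit [MeasurableSpace S] in
/-- UNIFORM absolute summability (the tree's `Potential.HasSummableBound`, = BKL's condition b),
eq. (2.6)) implies pointwise absolute summability at EVERY configuration (BKL 1998, §2: (2.9) is the
weakening of (2.6)). [cite: BricmontKupiainenLefevere1998, eqs. (2.6) and (2.9)] -/
theorem Potential.HasSummableBound.absSummableAt {Φ : Potential V S} {b : Finset V → ℝ}
    (h : Φ.HasSummableBound b) (ω : V → S) : Φ.AbsSummableAt ω := by
  intro i
  refine Summable.of_nonneg_of_le (fun B => ?_) (fun B => ?_) (h.summable i)
  · split_ifs
    · exact abs_nonneg _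
    · exact le_rfl
  · split_ifs
    · exact h.abs_le B ω
    · exact le_rfl

/-! ### Tail-measurable sets -/

/-- **Tail(-measurable) event**: `A` is measurable with respect to the outside σ-algebra
`𝓕_{Λᶜ} = cylinderEvents (↑Λ)ᶜ` of EVERY finite volume `Λ`, i.e. `A ∈ ⋂_Λ 𝓕_{Λᶜ}` (Georgii 2011,
(1.4) tail σ-field; the «tail field set» of Maes–Redig–Van Moffaert 1999 Def. 4.3 and the
«tail-measurable set `Ω_Φ`» of Le Ny 2008 Def. 32; BKL 1998 use translation-invariant tail sets).
[cite: MaesRedigVanmoffaertSPA1999, Def. 4.3] -/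
def IsTailMeasurable (A : Set (V → S)) : Prop :=
  ∀ Λ : Finset V, MeasurableSet[cylinderEvents ((↑Λ : Set V)ᶜ)] A

omit [DecidableEq V] in
/-- The whole configuration space is a tail event. [cite: Georgii2011, (1.4)] -/
@[simp] theorem isTailMeasurable_univ : IsTailMeasurable (Set.univ : Set (V → S)) :=
  fun _ => MeasurableSet.univ

omit [DecidableEq V] in
/-- A tail event is measurable for the full product σ-algebra (take `Λ = ∅`: `𝓕_{∅ᶜ} ≤ 𝓕`).
[cite: Georgii2011, (1.4)] -/
theorem IsTailMeasurable.measurableSet {A : Set (V → S)} (hA : IsTailMeasurable A) :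
    MeasurableSet A := by
  exact cylinderEvents_le_pi _ (hA ∅)

/-! ### The partly defined specification of a pair `(Φ, Ω̄)` and weakly Gibbsian measures -/

/-- **The partly defined Gibbsian specification `π^{Φ,Ω̄}` of the pair `(Φ, Ω̄)`**
(Bricmont–Kupiainen–Lefevere 1998, display after (2.9): `π^{Φ,Ω̄}_V(· | s̄) = Z⁻¹(s̄) e^{−H(·|s̄)}` for
`s̄ ∈ Ω̄` and `= 0` for `s̄ ∉ Ω̄`; Dobrushin–Shlosman 1999, p.128, «partly defined Gibbs
specification»): for a boundary condition in `Ω̄` the tree's Gibbsian kernel of the absolutely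
summable potential `β Φ` with a priori measure `ν` (`gibbsSpecOfSummablePotential`, series
Hamiltonian `hamiltonianTsum`), and the ZERO measure otherwise (verbatim BKL). It is a genuine
`Specification` in Georgii's sense only in special cases (e.g. `Ω̄ = univ`, `gibbsSpecOn_univ`);
the printed notion asks for the DLR equations on `Ω̄` only, see `IsWeaklyGibbsFor`.
[cite: BricmontKupiainenLefevere1998, §2 (display after (2.9))] -/
def gibbsSpecOn (ν : Measure S) (Φ : Potential V S) (Ωbar : Set (V → S)) (β : ℝ) :
    Specification V S :=
  open Classical in fun Λ η => if η ∈ Ωbar then gibbsSpecOfSummablePotential ν Φ β Λ η else 0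

/-- On `Ω̄` the partly defined specification is the Gibbsian kernel of `β Φ`.
[cite: BricmontKupiainenLefevere1998, §2 (display after (2.9))] -/
@[simp] theorem gibbsSpecOn_of_mem (ν : Measure S) (Φ : Potential V S) {Ωbar : Set (V → S)}
    (β : ℝ) (Λ : Finset V) {η : V → S} (hη : η ∈ Ωbar) :
    gibbsSpecOn ν Φ Ωbar β Λ η = gibbsSpecOfSummablePotential ν Φ β Λ η := by
  simp [gibbsSpecOn, hη]

/-- Off `Ω̄` the partly defined specification is the zero measure (BKL: «`0` for `s̄_{V^c} ∉ Ω̄`»).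
[cite: BricmontKupiainenLefevere1998, §2 (display after (2.9))] -/
@[simp] theorem gibbsSpecOn_of_not_mem (ν : Measure S) (Φ : Potential V S) {Ωbar : Set (V → S)}
    (β : ℝ) (Λ : Finset V) {η : V → S} (hη : η ∉ Ωbar) :
    gibbsSpecOn ν Φ Ωbar β Λ η = 0 := by
  simp [gibbsSpecOn, hη]

/-- With `Ω̄ = univ` the partly defined specification IS the Gibbsian specification of `β Φ`
(BKL 1998: «when condition (2.6) holds … this definition is very similar to the usual one»).
[cite: BricmontKupiainenLefevere1998, §2 (remark after the Definition)] -/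
@[simp] theorem gibbsSpecOn_univ (ν : Measure S) (Φ : Potential V S) (β : ℝ) :
    gibbsSpecOn ν Φ Set.univ β = gibbsSpecOfSummablePotential ν Φ β := by
  funext Λ η
  simp [gibbsSpecOn]

/-- **Weakly Gibbsian measure for the pair `(Φ, Ω̄)` at inverse temperature `β`, a priori measure
`ν`** (Bricmont–Kupiainen–Lefevere 1998, Definition «Gibbs measure for the pair `(Φ, Ω̄)`»;
Maes–Redig–Van Moffaert 1999, Def. 4.3; Le Ny 2008, Def. 32; Dobrushin–Shlosman 1999, (1.12) +
(1.5)): `Ω̄` is a tail event of full `μ`-measure, `Φ` is absolutely summable at every configuration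
of `Ω̄`, and `μ` is a probability measure satisfying the DLR equations for the partly defined
specification `π^{Φ,Ω̄}` — in the tree's junk-free form `∫⁻ π_Λ(A | η) dμ(η) = μ(A)` of
`IsGibbsMeasure` (since `μ(Ω̄ᶜ) = 0` and `π^{Φ,Ω̄}_Λ(· | η) = 0` off `Ω̄`, this is the printed
«`μ(s_V | s̄_{V^c}) = π^{Φ,Ω̄}_V(s_V | s̄_{V^c})` for all `s̄ ∈ Ω̄`» integrated against `μ`).
[cite: BricmontKupiainenLefevere1998, Definition before Theorem 1]
[cite: MaesRedigVanmoffaertSPA1999, Def. 4.3] -/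
def IsWeaklyGibbsFor (ν : Measure S) (Φ : Potential V S) (Ωbar : Set (V → S)) (β : ℝ)
    (μ : Measure (V → S)) : Prop :=
  IsTailMeasurable Ωbar ∧ μ Ωbarᶜ = 0 ∧ (∀ ω ∈ Ωbar, Φ.AbsSummableAt ω) ∧
    IsGibbsMeasure (gibbsSpecOn ν Φ Ωbar β) μ

/-- **Weakly Gibbsian measure** (Maes–Redig–Van Moffaert 1999, Def. 4.3; Le Ny 2008, Def. 32:
«there exists a potential `Φ` and a tail-measurable set `Ω_Φ` on which `Φ` is convergent with
`μ(Ω_Φ) = 1` such that `μ ∈ G(γ^Φ)`»): some adapted potential and some full-measure tail set make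
`μ` weakly Gibbsian for the pair (at `β = 1`, the temperature being absorbed in the potential as in
all the sources), relative to the a priori single-spin measure `ν`.
[cite: Leny2008, Def. 32] [cite: MaesRedigVanmoffaertSPA1999, Def. 4.3] -/
def IsWeaklyGibbs (ν : Measure S) (μ : Measure (V → S)) : Prop :=
  ∃ (Φ : Potential V S) (Ωbar : Set (V → S)), Φ.IsAdapted ∧ IsWeaklyGibbsFor ν Φ Ωbar 1 μ

/-- A weakly Gibbsian measure gives full measure to its set of good configurations
(`μ(Ω̄) = 1` in the sources; here `μ(Ω̄ᶜ) = 0`). [cite: MaesRedigVanmoffaertSPA1999, Def. 4.3 (2)] -/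
theorem IsWeaklyGibbsFor.measure_compl {ν : Measure S} {Φ : Potential V S} {Ωbar : Set (V → S)}
    {β : ℝ} {μ : Measure (V → S)} (h : IsWeaklyGibbsFor ν Φ Ωbar β μ) : μ Ωbarᶜ = 0 :=
  h.2.1

/-- **A Gibbs measure of a uniformly absolutely summable potential is weakly Gibbsian for the
pair `(Φ, univ)`** — the trivial inclusion «Gibbs ⟹ weakly Gibbs» (BKL 1998, remark after the
Definition: with (2.6) «the conditional probabilities can be extended everywhere»; Le Ny 2008 after
Def. 32). [cite: BricmontKupiainenLefevere1998, §2 (remark after the Definition)] -/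
theorem IsGibbsMeasure.isWeaklyGibbsFor_univ {ν : Measure S} {Φ : Potential V S}
    {b : Finset V → ℝ} (hb : Φ.HasSummableBound b) {β : ℝ} {μ : Measure (V → S)}
    (hμ : IsGibbsMeasure (gibbsSpecOfSummablePotential ν Φ β) μ) :
    IsWeaklyGibbsFor ν Φ Set.univ β μ := by
  refine ⟨isTailMeasurable_univ, by simp, fun ω _ => hb.absSummableAt ω, ?_⟩
  simpa only [gibbsSpecOn_univ] using hμ

/-- **On `Ω̄ = univ`, «weakly Gibbsian for `(Φ, univ)`» is exactly «pointwise absolutely summable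
everywhere and DLR-Gibbs for the Gibbsian specification of `β Φ`»** — the reduction of the
generalized notion to the standard one (BKL 1998, remark after the Definition; Le Ny 2008 after
Def. 32: weak Gibbsianness relaxes only the convergence set of the potential).
[cite: BricmontKupiainenLefevere1998, §2 (remark after the Definition)] -/
theorem isWeaklyGibbsFor_univ_iff {ν : Measure S} {Φ : Potential V S} {β : ℝ}
    {μ : Measure (V → S)} :
    IsWeaklyGibbsFor ν Φ Set.univ β μ ↔
      (∀ ω, Φ.AbsSummableAt ω) ∧ IsGibbsMeasure (gibbsSpecOfSummablePotential ν Φ β) μ := by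
  simp only [IsWeaklyGibbsFor, isTailMeasurable_univ, Set.compl_univ, measure_empty, Set.mem_univ,
    forall_const, true_and, gibbsSpecOn_univ]

/-! ### Almost Gibbsian (almost quasilocal) measures -/

/-- **The continuity set `Ω_γ` of a specification** (Maes–Redig–Van Moffaert 1999, §2 and
Def. 4.2: the set of configurations at which (a version of) the conditional probabilities is
continuous; Fernández–Le Ny–Redig 2003; Le Ny 2008, Def. 33 «`Ω_γ`»): the boundary conditions `η`
at which EVERY kernel `η' ↦ ∫ f dγ_Λ(· | η')`, `f` bounded continuous, is continuous (product
topology). For a finite single-spin space this is the set of points of quasilocality.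
[cite: MaesRedigVanmoffaertSPA1999, Def. 4.2] -/
def Specification.continuitySet [TopologicalSpace S] (γ : Specification V S) : Set (V → S) :=
  {η | ∀ (Λ : Finset V) (f : (V → S) →ᵇ ℝ), ContinuousAt (fun η' : V → S => ∫ σ, f σ ∂(γ Λ η')) η}

/-- **Almost Gibbsian (almost quasilocal) measure** (Le Ny 2008, Def. 33: «there exists a
specification `γ` such that `μ ∈ G(γ)` and `μ(Ω_γ) = 1`»; Fernández–Le Ny–Redig 2003;
Maes–Redig–Van Moffaert 1999, Def. 4.2, who additionally require `γ` to be uniformly nonnull —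
that extra condition is NOT encoded here): `μ` is a DLR Gibbs measure for some specification in
Georgii's sense whose continuity set has full `μ`-measure (`μ(Ω_γᶜ) = 0`). Almost Gibbs implies
weakly Gibbs (MRvM Thm. 4.1, via Kozlov–Sullivan; not formalised) and not conversely (MRvM §5.2).
[cite: Leny2008, Def. 33] [cite: MaesRedigVanmoffaertSPA1999, Def. 4.2] -/
def IsAlmostGibbs [TopologicalSpace S] (μ : Measure (V → S)) : Prop :=
  ∃ γ : Specification V S, IsSpecification γ ∧ IsGibbsMeasure γ μ ∧ μ (γ.continuitySet)ᶜ = 0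

omit [DecidableEq V] in
/-- If every kernel of `γ` is continuous in the boundary condition (a Feller = quasilocal
specification, van Enter–Fernández–Sokal 1993 Def. 2.14, the tree's
`NonGibbs.Specification.IsFeller`), the continuity set is everything.
[cite: MaesRedigVanmoffaertSPA1999, Def. 4.1] -/
theorem Specification.continuitySet_eq_univ [TopologicalSpace S] {γ : Specification V S}
    (hγ : ∀ (Λ : Finset V) (f : (V → S) →ᵇ ℝ), Continuous fun η : V → S => ∫ σ, f σ ∂(γ Λ η)) :
    γ.continuitySet = Set.univ :=
  Set.eq_univ_of_forall fun _ Λ f => (hγ Λ f).continuousAt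

omit [DecidableEq V] in
/-- **Every Gibbs measure (for a quasilocal specification) is almost Gibbsian**
(Maes–Redig–Van Moffaert 1999, Remark 1 after Def. 4.2: «Of course every Gibbs measure is almost
Gibbsian»; Le Ny 2008, the ladder after Def. 34: «for all `ω` … when `μ` is Gibbs (quasilocal)»).
[cite: MaesRedigVanmoffaertSPA1999, Def. 4.2 Remark 1] -/
theorem IsGibbsMeasure.isAlmostGibbs_of_continuous [TopologicalSpace S] {γ : Specification V S}
    (hγ : IsSpecification γ)
    (hcont : ∀ (Λ : Finset V) (f : (V → S) →ᵇ ℝ), Continuous fun η : V → S => ∫ σ, f σ ∂(γ Λ η))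
    {μ : Measure (V → S)} (hμ : IsGibbsMeasure γ μ) : IsAlmostGibbs μ :=
  ⟨γ, hγ, hμ, by rw [Specification.continuitySet_eq_univ hcont, Set.compl_univ, measure_empty]⟩

end Literature.Probability.LatticeModels
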